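import Mathlib
import Summits.NavierStokesRegularity.NavierStokesRegularity.Theorems.FilamentSkeletonRssClause13SymbolDecay

/-!
# Clause 13-J, brick B4-prep: the FOURIER TRANSFORM (Mathlib convention) of the B2 smoothing kernel,
# `𝓕 K_q (ξ) = (2/q)·(1 − 𝔖(2π|ξ|√q))`, real and in `[0, 2/q]`

Route `FilamentSkeletonRss`, child 28296 `Clause13NearStraight` (and its A1L twin); design of record
`filament-plan/DESIGN-NOTE-28296-tenure-g22.md` §4–§5 (band virial and slice estimates in `L²`: every quadratic form of the model
self operator `c_M·J(I − k_q∗)` is evaluated on the Fourier side through the symbol).  With Mathlib's `𝓕 f ξ = ∫ e^{−2πi ξ s} f(s) ds`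
(`Real.fourier_real_eq_integral_exp_smul`) and the cosine/sine transforms of `…Clause13SymbolDecay` (`integral_smoothingKernel_cos/_sin`,
p662338), the kernel `K_q(s) = (2q − s²)(s²+q)^{-5/2}` of `taylorRemainderOp_eq` (B2) has

* `fourier_smoothingKernel` : `𝓕 K_q ξ = ((2/q)(1 − liaSym(2πξ√q)) : ℂ)` — real (the kernel is even), so the probability kernel
  `k_q = (q/2)K_q` has multiplier `1 − 𝔖(2πξ√q) ∈ [0, 1]` (`one_sub_liaSym_nonneg`, `liaSym ≤ 1 − 0`), `≤ 5e^{−π|ξ|√q}`.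

Lane ns-filament-19175-p1 g13; `--supports stmt-NavierStokesRegularity-28296 --as helper`.  Typing-agnostic.
HONEST FRAMING: a Fourier transform of an explicit kernel attached to a HYPOTHETICAL filament skeleton on the NEGATIVE side of a MODEL
route; nothing here bears on Navier–Stokes regularity or blow-up.
-/

noncomputable section

open MeasureTheory Real Complex
open scoped FourierTransform
open Summit.NavierStokesRegularity.NavierStokesRegularity.Theorems.AnalyticStripLiaSymbol (liaSym)

namespace Summit.NavierStokesRegularity.NavierStokesRegularity.Theorems.MatchedKernel
set_option linter.dupNamespace false

/-- `|2q − s²|(s²+q)^{-5/2} ≤ 2(s²+q)^{-3/2}`: the smoothing kernel is dominated by twice the B1 kernel. [folklore] -/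
theorem abs_smoothingKernel_le {q : ℝ} (hq : 0 < q) (s : ℝ) :
    |(2 * q - s ^ 2) * ((s ^ 2 + q) ^ (5 / 2 : ℝ))⁻¹| ≤ 2 * ((s ^ 2 + q) ^ (3 / 2 : ℝ))⁻¹ := by
  have hσ : 0 < s ^ 2 + q := by positivity
  have h5 : (s ^ 2 + q) ^ (5 / 2 : ℝ) = (s ^ 2 + q) * (s ^ 2 + q) ^ (3 / 2 : ℝ) := by
    rw [show (5 / 2 : ℝ) = 1 + 3 / 2 by norm_num, Real.rpow_add hσ, Real.rpow_one]
  have h3 : 0 < (s ^ 2 + q) ^ (3 / 2 : ℝ) := Real.rpow_pos_of_pos hσ _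
  rw [abs_mul, abs_of_pos (inv_pos.mpr (Real.rpow_pos_of_pos hσ _)), h5, mul_inv]
  have hnum : |2 * q - s ^ 2| ≤ 2 * (s ^ 2 + q) := by
    rw [abs_le]; constructor <;> nlinarith [sq_nonneg s]
  calc |2 * q - s ^ 2| * ((s ^ 2 + q)⁻¹ * ((s ^ 2 + q) ^ (3 / 2 : ℝ))⁻¹)
      ≤ (2 * (s ^ 2 + q)) * ((s ^ 2 + q)⁻¹ * ((s ^ 2 + q) ^ (3 / 2 : ℝ))⁻¹) := by gcongr
    _ = 2 * ((s ^ 2 + q) ^ (3 / 2 : ℝ))⁻¹ := by field_simp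

/-- Continuity of the smoothing kernel. [folklore] -/
theorem continuous_smoothingKernel {q : ℝ} (hq : 0 < q) :
    Continuous (fun s : ℝ => (2 * q - s ^ 2) * ((s ^ 2 + q) ^ (5 / 2 : ℝ))⁻¹) := by
  have hσ : ∀ s : ℝ, 0 < s ^ 2 + q := fun s => by positivity
  have hK5c : Continuous (fun s : ℝ => ((s ^ 2 + q) ^ (5 / 2 : ℝ))⁻¹) := (((continuous_pow 2).add continuous_const).rpow_const
    (fun s => Or.inl (hσ s).ne')).inv₀ (fun s => (Real.rpow_pos_of_pos (hσ s) _).ne')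
  exact (continuous_const.sub (continuous_pow 2)).mul hK5c

/-- Integrability of the smoothing kernel against a bounded continuous weight (`|φ| ≤ 1`). [folklore] -/
theorem integrable_smoothingKernel_mul {q : ℝ} (hq : 0 < q) {φ : ℝ → ℝ} (hφc : Continuous φ) (hφ : ∀ s, |φ s| ≤ 1) :
    Integrable (fun s : ℝ => (2 * q - s ^ 2) * ((s ^ 2 + q) ^ (5 / 2 : ℝ))⁻¹ * φ s) := by
  refine Integrable.mono' ((integrable_inv_one_add_sq.const_mul (2 * ((Real.sqrt q)⁻¹ * max 1 q⁻¹))))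
    (((continuous_smoothingKernel hq).mul hφc).aestronglyMeasurable) (Filter.Eventually.of_forall fun s => ?_)
  rw [Real.norm_eq_abs, abs_mul]
  calc |(2 * q - s ^ 2) * ((s ^ 2 + q) ^ (5 / 2 : ℝ))⁻¹| * |φ s|
      ≤ (2 * ((s ^ 2 + q) ^ (3 / 2 : ℝ))⁻¹) * 1 := by
        gcongr
        · exact abs_smoothingKernel_le hq s
        · exact hφ s
    _ ≤ 2 * ((Real.sqrt q)⁻¹ * max 1 q⁻¹ * (1 + s ^ 2)⁻¹) := by
        rw [mul_one]; gcongr; exact K3_le_inv_one_add_sq hq s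
    _ = 2 * ((Real.sqrt q)⁻¹ * max 1 q⁻¹) * (1 + s ^ 2)⁻¹ := by ring

/-- **The multiplier of the smoothing kernel (Mathlib convention).**  `𝓕 K_q ξ = (2/q)(1 − 𝔖(2πξ√q))`, a real number:
cosine part from `integral_smoothingKernel_cos`, sine part zero by `integral_smoothingKernel_sin` (both at `τ = 0`). [folklore] -/
theorem fourier_smoothingKernel {q : ℝ} (hq : 0 < q) (ξ : ℝ) :
    𝓕 (fun s : ℝ => (((2 * q - s ^ 2) * ((s ^ 2 + q) ^ (5 / 2 : ℝ))⁻¹ : ℝ) : ℂ)) ξ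
      = ((2 / q * (1 - liaSym (2 * π * ξ * √q)) : ℝ) : ℂ) := by
  rw [Real.fourier_real_eq_integral_exp_smul]
  set K : ℝ → ℝ := fun s => (2 * q - s ^ 2) * ((s ^ 2 + q) ^ (5 / 2 : ℝ))⁻¹ with hK
  -- pointwise: `e^{−2πi s ξ} K(s) = K(s)cos(2πξ s) − i K(s) sin(2πξ s)`
  have hpt : ∀ s : ℝ, cexp (((-2 * π * s * ξ : ℝ) : ℂ) * I) • ((K s : ℝ) : ℂ)
      = ((K s * Real.cos (2 * π * ξ * s) : ℝ) : ℂ) + ((-(K s * Real.sin (2 * π * ξ * s)) : ℝ) : ℂ) * I := by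
    intro s
    rw [smul_eq_mul, Complex.exp_mul_I, ← Complex.ofReal_cos, ← Complex.ofReal_sin]
    have h1 : Real.cos (-2 * π * s * ξ) = Real.cos (2 * π * ξ * s) := by
      rw [← Real.cos_neg]; ring_nf
    have h2 : Real.sin (-2 * π * s * ξ) = -Real.sin (2 * π * ξ * s) := by
      rw [← Real.sin_neg]; ring_nf
    rw [h1, h2]
    push_cast
    ring
  refine (integral_congr_ae (Filter.Eventually.of_forall fun s => hpt s)).trans ?_
  have hIc : Integrable (fun s : ℝ => K s * Real.cos (2 * π * ξ * s)) :=
    integrable_smoothingKernel_mul hq (by fun_prop) (fun s => Real.abs_cos_le_one _)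
  have hIs : Integrable (fun s : ℝ => -(K s * Real.sin (2 * π * ξ * s))) :=
    (integrable_smoothingKernel_mul hq (by fun_prop) (fun s => Real.abs_sin_le_one _)).neg
  have hIc' : Integrable (fun s : ℝ => ((K s * Real.cos (2 * π * ξ * s) : ℝ) : ℂ)) := hIc.ofReal
  have hIs' : Integrable (fun s : ℝ => ((-(K s * Real.sin (2 * π * ξ * s)) : ℝ) : ℂ) * I) :=
    hIs.ofReal.mul_const _
  rw [integral_add hIc' hIs', integral_mul_const, integral_complex_ofReal, integral_complex_ofReal]
  -- evaluate the two real integrals at `τ = 0`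
  have hcos : ∫ s : ℝ, K s * Real.cos (2 * π * ξ * s) = 2 / q * (1 - liaSym (2 * π * ξ * √q)) := by
    have h := integral_smoothingKernel_cos hq (2 * π * ξ) 0
    simp only [zero_sub, even_two, Even.neg_pow, mul_zero, Real.cos_zero, mul_one] at h
    simpa [hK] using h
  have hsin : ∫ s : ℝ, -(K s * Real.sin (2 * π * ξ * s)) = 0 := by
    rw [integral_neg]
    have h := integral_smoothingKernel_sin hq (2 * π * ξ) 0
    simp only [zero_sub, even_two, Even.neg_pow, mul_zero, Real.sin_zero] at h
    simp [hK, h]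
  rw [hcos, hsin]
  push_cast
  ring

end Summit.NavierStokesRegularity.NavierStokesRegularity.Theorems.MatchedKernel
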